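import Summits.RiemannHypothesis.RiemannHypothesis.Theorems.TiltedLandingLaw421R3SinkK1SmallNear
import Summits.RiemannHypothesis.RiemannHypothesis.Theorems.TiltedLandingLaw421R3SinkK1SmallFar
import Summits.RiemannHypothesis.RiemannHypothesis.Theorems.TiltedLandingLaw421R3SinkK1SmallLidA
import Summits.RiemannHypothesis.RiemannHypothesis.Theorems.TiltedLandingLaw421R3SinkK1SmallLidB
import Summits.RiemannHypothesis.RiemannHypothesis.Theorems.TiltedLandingLaw421R3SinkK1SmallLidC
import Summits.RiemannHypothesis.RiemannHypothesis.Theorems.TiltedLandingLaw421R3SinkK1LidLink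

/-!
# C3 (rh-idea-3 g57) — «K1SmallLink»: rule-`y0 = 1` boundary domination (K∂) at `R = 2` on SMALL `0 < t ≤ 1/8`

LINK file (imports the five SMALL certificate files + 133 «K1LidLink»; #1272 «K1Near», #1278 «K1FarB», 130–132 arrive transitively).  For a right-sided strict
cone child `0 ≤ d < 1`, `d(2−d) < t²` with `0 < t ≤ 1/8` (hence `d ≤ 1/127`, `d_le_of_small`) and any top height `h`, all four conjuncts of 110's
`BdryDomForm 2 d t h 1 (cornerSigmaForm 2 d t h 1)` hold: near column (#1272's `near_column_dom_of_qtilde` fed by `q0/q1/q2_pos_small`), far column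
(122's identity/assembly with the piece facts abstracted: `far_column_dom_of_split`, fed by `f0/f1/f2/g3_pos_small`), right/left lid (133's `lid_identity` /
`lid_dom_of_key` with `lidSum ≥ 0` from `g0,c1…c8_pos_small`: `lidSum_nonneg_right/left_of_pieces`, `right/left_lid_of_lidSum`); ★`bdryDomForm_two_K1_small`.
Together with 134's `bdryDomForm_two_K1_main` (MAIN `1/8 ≤ t ≤ 2/3`) this covers the whole rule-`y0 = 1` region at `R = 2` (see «K1EndsOne»).
Namespace `RhW08.K1Small`; nothing of 102/110/113/118/120–122/130–134 re-declared; 0 `sorry`; 0 `set_option`.  Level: SUPPORT (K + certified inequalities);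
asserts no law.  Nothing here bears on the truth of RH; RH is not proved.
-/

noncomputable section

namespace RhW08.K1Small

open RhW08.SinkBdry RhW08.K1NearBox RhW08.K1FarBox RhW08.K1LidBox RhW08.K1Lid RhW08.K1SmallBox

/-- geometry of SMALL: a strict cone child (`d(2−d) < t²`, `0 ≤ d < 1`) with `t ≤ 1/8` has `d ≤ 1/127` (indeed `d < 1 − √(63/64)`). -/
theorem d_le_of_small (t d : ℝ) (ht : t ≤ ((1 : ℝ) / 8)) (ht₀ : 0 < t) (hd1 : d < 1) (hcone : d * (2 - d) < t ^ 2) :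
    d ≤ ((1 : ℝ) / 127) := by
  by_contra hc
  push Not at hc
  have h1 : t ^ 2 ≤ 1 / 64 := by nlinarith
  have h2 : (0 : ℝ) ≤ (d - 1 / 127) * (2 - 1 / 127 - d) := mul_nonneg (by linarith) (by linarith)
  nlinarith

/-! ## Near column on SMALL -/

/-- ★ NEAR-COLUMN K1 ON SMALL (R = 2): conjunct 1 of `BdryDomForm 2 d t h 1 (cornerSigmaForm 2 d t h 1)` for `0 < t ≤ 1/8`. -/
theorem near_column_K1_small (d t h b : ℝ) (ht₀ : 0 < t) (ht : t ≤ ((1 : ℝ) / 8)) (hd₀ : (0 : ℝ) ≤ d) (hd1 : d < 1)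
    (hcone : d * (2 - d) < t ^ 2) (hb0 : 0 ≤ b) (hb1 : b ≤ 1) :
    twoPointNForm d t h 1 1 b ≤ cornerSigmaForm 2 d t h 1 * pairCForm d t 1 b := by
  have hd := d_le_of_small t d ht ht₀ hd1 hcone
  have h0 := q0_pos_small t d ht₀ ht hd₀ hd
  have h1 := q1_pos_small t d ht₀ ht hd₀ hd
  have h2 := q2_pos_small t d ht₀ ht hd₀ hd
  have hbsq : b ^ 2 ≤ 1 := by nlinarith
  have hq : 0 ≤ q0 t d + q1 t d * b ^ 2 + q2 t d * b ^ 4 := by positivity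
  exact RhW08.K1NearColumnLink.near_column_dom_of_qtilde d t h b hd₀ hd1 ht₀ hb0 hb1 hq
    (RhW08.K1NearColumnLink.pairCForm_near_pos d t 1 hd1 ht₀ hcone (by norm_num))
    (RhW08.K1NearColumnLink.pairCForm_near_pos d t b hd1 ht₀ hcone hbsq).le

/-! ## Far column on SMALL -/

/-- far-column domination from the nonnegativity of 122's split `f0·(1−b²)³ + 3f1·b²(1−b²)² + 3f2·b⁴(1−b²) + d·g3·b⁶` (122's assembly with the piece facts
abstracted; any right-sided strict cone child with `d < 1`). -/
theorem far_column_dom_of_split (d t h b : ℝ) (hd₀ : (0 : ℝ) ≤ d) (hd1 : d < 1) (ht₀ : 0 < t) (hcone : d * (2 - d) < t ^ 2) (hb0 : 0 ≤ b) (hb1 : b ≤ 1)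
    (hsplit : 0 ≤ f0 t d * (1 - b ^ 2) ^ 3 + 3 * f1 t d * b ^ 2 * (1 - b ^ 2) ^ 2 + 3 * f2 t d * b ^ 4 * (1 - b ^ 2) + d * g3 t d * b ^ 6) :
    twoPointNForm d t h 1 (-1) b ≤ cornerSigmaForm 2 d t h 1 * pairCForm d t (-1) b := by
  have hbsq : b ^ 2 ≤ 1 := by nlinarith
  have hrhs : 0 ≤ t * d * (f0 t d * (1 - b ^ 2) ^ 3 + 3 * f1 t d * b ^ 2 * (1 - b ^ 2) ^ 2 + 3 * f2 t d * b ^ 4 * (1 - b ^ 2) + d * g3 t d * b ^ 6) :=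
    mul_nonneg (mul_nonneg ht₀.le hd₀) hsplit
  have hdd : 0 < (d - 1) ^ 2 := by
    rw [show (d - 1) ^ 2 = (1 - d) ^ 2 by ring]; exact pow_pos (by linarith) 2
  have hP1 : 0 < ((1 + (t - 1) ^ 2) * (1 + (t + 1) ^ 2)) * (((d - 1) ^ 2 + (t - 1) ^ 2) * ((d - 1) ^ 2 + (t + 1) ^ 2)) :=
    mul_pos (by positivity) (mul_pos (add_pos_of_pos_of_nonneg hdd (sq_nonneg _)) (add_pos_of_pos_of_nonneg hdd (sq_nonneg _)))
  have hP2 : 0 < ((1 + (t - b) ^ 2) * (1 + (t + b) ^ 2)) * (((d + 1) ^ 2 + (t - b) ^ 2) * ((d + 1) ^ 2 + (t + b) ^ 2)) := by positivity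
  have iden := RhW08.K1FarColumn.far_column_identity d t h b hd₀ hd1
  have key : 0 ≤ twoPointNForm d t h 1 1 1 * pairCForm d t (-1) b - twoPointNForm d t h 1 (-1) b * pairCForm d t 1 1 := by
    rw [← iden] at hrhs
    exact (mul_nonneg_iff_of_pos_right hP1).1 ((mul_nonneg_iff_of_pos_right hP2).1 hrhs)
  have hc1 := RhW08.K1FarColumn.pairCForm_near_corner_pos d t hd1 ht₀ hcone
  have hcb := (RhW08.K1FarColumn.pairCForm_far_pos d t b hd₀ ht₀ hbsq).le
  have step1 : twoPointNForm d t h 1 (-1) b ≤ (twoPointNForm d t h 1 1 1 / pairCForm d t 1 1) * pairCForm d t (-1) b := by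
    rw [div_mul_eq_mul_div, le_div_iff₀ hc1]
    linarith
  have step2 : (twoPointNForm d t h 1 1 1 / pairCForm d t 1 1) * pairCForm d t (-1) b ≤ cornerSigmaForm 2 d t h 1 * pairCForm d t (-1) b := by
    rw [RhW08.K1NearColumnLink.cornerSigmaForm_two]
    exact mul_le_mul_of_nonneg_right (le_max_left _ _) hcb
  exact step1.trans step2

/-- ★ FAR-COLUMN K1 ON SMALL (R = 2): conjunct 2 of `BdryDomForm 2 d t h 1 (cornerSigmaForm 2 d t h 1)` for `0 < t ≤ 1/8`. -/
theorem far_column_K1_small (d t h b : ℝ) (ht₀ : 0 < t) (ht : t ≤ ((1 : ℝ) / 8)) (hd₀ : (0 : ℝ) ≤ d) (hd1 : d < 1)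
    (hcone : d * (2 - d) < t ^ 2) (hb0 : 0 ≤ b) (hb1 : b ≤ 1) :
    twoPointNForm d t h 1 (-1) b ≤ cornerSigmaForm 2 d t h 1 * pairCForm d t (-1) b := by
  have hd := d_le_of_small t d ht ht₀ hd1 hcone
  have e0 := f0_pos_small t d ht₀ ht hd₀ hd
  have e1 := f1_pos_small t d ht₀ ht hd₀ hd
  have e2 := f2_pos_small t d ht₀ ht hd₀ hd
  have e3 := g3_pos_small t d ht₀ ht hd₀ hd
  have hB1 : 0 ≤ 1 - b ^ 2 := by nlinarith
  have hsplit : 0 ≤ f0 t d * (1 - b ^ 2) ^ 3 + 3 * f1 t d * b ^ 2 * (1 - b ^ 2) ^ 2 + 3 * f2 t d * b ^ 4 * (1 - b ^ 2) + d * g3 t d * b ^ 6 := by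
    have hb4 : b ^ 4 = (b ^ 2) ^ 2 := by ring
    have hb6 : b ^ 6 = (b ^ 2) ^ 3 := by ring
    rw [hb4, hb6]
    generalize 1 - b ^ 2 = B1 at hB1
    positivity
  exact far_column_dom_of_split d t h b hd₀ hd1 ht₀ hcone hb0 hb1 hsplit

/-! ## Lids on SMALL -/

/-- `lidSum ≥ 0` on the right lid ray `ξ ≥ 1` from the nine piece facts (133's proof with the box facts abstracted). -/
theorem lidSum_nonneg_right_of_pieces (t d ξ : ℝ) (e0 : 0 < g0 t d) (e1 : 0 < c1 t d) (e2 : 0 < c2 t d) (e3 : 0 < c3 t d) (e4 : 0 < c4 t d)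
    (e5 : 0 < c5 t d) (e6 : 0 < c6 t d) (e7 : 0 < c7 t d) (e8 : 0 < c8 t d) (hd₀ : 0 ≤ d) (hξ : 1 ≤ ξ) : 0 ≤ lidSum t d ξ := by
  have hp : 0 ≤ ξ - 1 := by linarith
  have hq : 0 ≤ ξ + 1 := by linarith
  unfold lidSum
  generalize g0 t d = G0 at e0; generalize c1 t d = C1 at e1; generalize c2 t d = C2 at e2; generalize c3 t d = C3 at e3
  generalize c4 t d = C4 at e4; generalize c5 t d = C5 at e5; generalize c6 t d = C6 at e6; generalize c7 t d = C7 at e7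
  generalize c8 t d = C8 at e8
  generalize ξ - 1 = p at hp; generalize ξ + 1 = q at hq
  positivity

/-- `lidSum ≥ 0` on the left lid ray `ξ ≤ −1` from the nine piece facts. -/
theorem lidSum_nonneg_left_of_pieces (t d ξ : ℝ) (e0 : 0 < g0 t d) (e1 : 0 < c1 t d) (e2 : 0 < c2 t d) (e3 : 0 < c3 t d) (e4 : 0 < c4 t d)
    (e5 : 0 < c5 t d) (e6 : 0 < c6 t d) (e7 : 0 < c7 t d) (e8 : 0 < c8 t d) (hd₀ : 0 ≤ d) (hξ : ξ ≤ -1) : 0 ≤ lidSum t d ξ := by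
  obtain ⟨m, hm, hξm⟩ : ∃ m : ℝ, 0 ≤ m ∧ ξ = -1 - m := ⟨-1 - ξ, by linarith, by ring⟩
  have e : lidSum t d ξ = d * g0 t d * (m + 2) ^ 8 + 8 * c1 t d * m * (m + 2) ^ 7 + 28 * c2 t d * m ^ 2 * (m + 2) ^ 6 +
      56 * c3 t d * m ^ 3 * (m + 2) ^ 5 + 70 * c4 t d * m ^ 4 * (m + 2) ^ 4 + 56 * c5 t d * m ^ 5 * (m + 2) ^ 3 +
      28 * c6 t d * m ^ 6 * (m + 2) ^ 2 + 8 * c7 t d * m ^ 7 * (m + 2) + c8 t d * m ^ 8 := by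
    subst hξm; unfold lidSum; ring
  rw [e]
  generalize g0 t d = G0 at e0; generalize c1 t d = C1 at e1; generalize c2 t d = C2 at e2; generalize c3 t d = C3 at e3
  generalize c4 t d = C4 at e4; generalize c5 t d = C5 at e5; generalize c6 t d = C6 at e6; generalize c7 t d = C7 at e7
  generalize c8 t d = C8 at e8
  positivity

/-- right lid domination from `lidSum ≥ 0` (133's `right_lid_K1_main` with the box facts abstracted; any strict cone child with `0 ≤ d < 1`). -/
theorem right_lid_of_lidSum (d t h ξ : ℝ) (hd₁ : (0 : ℝ) ≤ d) (hd : d < 1) (ht : 0 < t) (hcone : d * (2 - d) < t ^ 2) (hξ : 1 ≤ ξ)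
    (hL : 0 ≤ lidSum t d ξ) : twoPointNForm d t h 1 ξ 1 ≤ cornerSigmaForm 2 d t h 1 * pairCForm d t ξ 1 := by
  have hξ2 : 1 ≤ ξ ^ 2 := by nlinarith
  have hfar : (1 - d) ^ 2 ≤ (d - ξ) ^ 2 := by nlinarith [mul_nonneg (sub_nonneg.mpr hξ) (by linarith : (0:ℝ) ≤ ξ + 1 - 2 * d)]
  have hM : 0 < (d - ξ) ^ 2 := lt_of_lt_of_le (pow_pos (by linarith) 2) hfar
  have hξ0 : 0 < ξ := by linarith
  have h256 : (0:ℝ) < 256 * ξ ^ 3 := by positivity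
  have hrhs : 0 ≤ t * d * ((ξ - 1) * lidSum t d ξ) := mul_nonneg (mul_nonneg ht.le hd₁) (mul_nonneg (by linarith) hL)
  have hc1 : 0 < pairCForm d t 1 1 := pairCForm_lid_pos d t 1 hd ht hcone (le_of_eq (by ring))
  have hcξ := (pairCForm_lid_pos d t ξ hd ht hcone hfar).le
  obtain ⟨hP1, hP2⟩ := lid_denoms_pos d t ξ hd hM hξ2
  have iden := lid_identity d t h ξ hd₁ hd hξ2
  have key : 0 ≤ twoPointNForm d t h 1 1 1 * pairCForm d t ξ 1 - twoPointNForm d t h 1 ξ 1 * pairCForm d t 1 1 := by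
    rw [← iden] at hrhs
    exact (mul_nonneg_iff_of_pos_right hP1).1 ((mul_nonneg_iff_of_pos_right hP2).1 ((mul_nonneg_iff_of_pos_right h256).1 hrhs))
  exact lid_dom_of_key d t h ξ hc1 hcξ key

/-- left lid domination from `lidSum ≥ 0` (133's `left_lid_K1_main` with the box facts abstracted). -/
theorem left_lid_of_lidSum (d t h ξ : ℝ) (hd₁ : (0 : ℝ) ≤ d) (hd : d < 1) (ht : 0 < t) (hcone : d * (2 - d) < t ^ 2) (hξ : 1 ≤ -ξ)
    (hL : 0 ≤ lidSum t d ξ) : twoPointNForm d t h 1 ξ 1 ≤ cornerSigmaForm 2 d t h 1 * pairCForm d t ξ 1 := by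
  have hξ' : ξ ≤ -1 := by linarith
  have hξ2 : 1 ≤ ξ ^ 2 := by nlinarith
  have hfar : (1 - d) ^ 2 ≤ (d - ξ) ^ 2 := by nlinarith [mul_nonneg (by linarith : (0:ℝ) ≤ 2 * d - ξ - 1) (by linarith : (0:ℝ) ≤ 1 - ξ)]
  have hM : 0 < (d - ξ) ^ 2 := lt_of_lt_of_le (pow_pos (by linarith) 2) hfar
  have hξ2pos : 0 < ξ ^ 2 := lt_of_lt_of_le one_pos hξ2
  have hneg : 256 * ξ ^ 3 < 0 := by
    have h3 : ξ * ξ ^ 2 < 0 := mul_neg_of_neg_of_pos (by linarith) hξ2pos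
    rw [show ξ ^ 3 = ξ * ξ ^ 2 by ring]; linarith
  have hy : 0 ≤ t * d * ((1 - ξ) * lidSum t d ξ) := mul_nonneg (mul_nonneg ht.le hd₁) (mul_nonneg (by linarith) hL)
  have hrhs : t * d * ((ξ - 1) * lidSum t d ξ) ≤ 0 := by
    rw [show t * d * ((ξ - 1) * lidSum t d ξ) = -(t * d * ((1 - ξ) * lidSum t d ξ)) by ring]; linarith
  have aux : ∀ {Y z : ℝ}, Y * z ≤ 0 → z < 0 → 0 ≤ Y := by
    intro Y z hYz hz
    by_contra h'
    push Not at h'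
    nlinarith [mul_pos_of_neg_of_neg h' hz]
  have hc1 : 0 < pairCForm d t 1 1 := pairCForm_lid_pos d t 1 hd ht hcone (le_of_eq (by ring))
  have hcξ := (pairCForm_lid_pos d t ξ hd ht hcone hfar).le
  obtain ⟨hP1, hP2⟩ := lid_denoms_pos d t ξ hd hM hξ2
  have iden := lid_identity d t h ξ hd₁ hd hξ2
  have key : 0 ≤ twoPointNForm d t h 1 1 1 * pairCForm d t ξ 1 - twoPointNForm d t h 1 ξ 1 * pairCForm d t 1 1 := by
    rw [← iden] at hrhs
    exact (mul_nonneg_iff_of_pos_right hP1).1 ((mul_nonneg_iff_of_pos_right hP2).1 (aux hrhs hneg))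
  exact lid_dom_of_key d t h ξ hc1 hcξ key

/-- ★ RIGHT LID K1 ON SMALL (R = 2): conjunct 3 of `BdryDomForm 2 d t h 1 (cornerSigmaForm 2 d t h 1)` for `0 < t ≤ 1/8`. -/
theorem right_lid_K1_small (d t h ξ : ℝ) (ht₀ : 0 < t) (ht : t ≤ ((1 : ℝ) / 8)) (hd₀ : (0 : ℝ) ≤ d) (hd1 : d < 1)
    (hcone : d * (2 - d) < t ^ 2) (hξ : 1 ≤ ξ) :
    twoPointNForm d t h 1 ξ 1 ≤ cornerSigmaForm 2 d t h 1 * pairCForm d t ξ 1 := by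
  have hd := d_le_of_small t d ht ht₀ hd1 hcone
  exact right_lid_of_lidSum d t h ξ hd₀ hd1 ht₀ hcone hξ
    (lidSum_nonneg_right_of_pieces t d ξ (g0_pos_small t d ht₀ ht hd₀ hd) (c1_pos_small t d ht₀ ht hd₀ hd) (c2_pos_small t d ht₀ ht hd₀ hd)
      (c3_pos_small t d ht₀ ht hd₀ hd) (c4_pos_small t d ht₀ ht hd₀ hd) (c5_pos_small t d ht₀ ht hd₀ hd) (c6_pos_small t d ht₀ ht hd₀ hd)
      (c7_pos_small t d ht₀ ht hd₀ hd) (c8_pos_small t d ht₀ ht hd₀ hd) hd₀ hξ)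

/-- ★ LEFT LID K1 ON SMALL (R = 2): conjunct 4 of `BdryDomForm 2 d t h 1 (cornerSigmaForm 2 d t h 1)` for `0 < t ≤ 1/8` (`1 ≤ −ξ`). -/
theorem left_lid_K1_small (d t h ξ : ℝ) (ht₀ : 0 < t) (ht : t ≤ ((1 : ℝ) / 8)) (hd₀ : (0 : ℝ) ≤ d) (hd1 : d < 1)
    (hcone : d * (2 - d) < t ^ 2) (hξ : 1 ≤ -ξ) :
    twoPointNForm d t h 1 ξ 1 ≤ cornerSigmaForm 2 d t h 1 * pairCForm d t ξ 1 := by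
  have hd := d_le_of_small t d ht ht₀ hd1 hcone
  exact left_lid_of_lidSum d t h ξ hd₀ hd1 ht₀ hcone hξ
    (lidSum_nonneg_left_of_pieces t d ξ (g0_pos_small t d ht₀ ht hd₀ hd) (c1_pos_small t d ht₀ ht hd₀ hd) (c2_pos_small t d ht₀ ht hd₀ hd)
      (c3_pos_small t d ht₀ ht hd₀ hd) (c4_pos_small t d ht₀ ht hd₀ hd) (c5_pos_small t d ht₀ ht hd₀ hd) (c6_pos_small t d ht₀ ht hd₀ hd)
      (c7_pos_small t d ht₀ ht hd₀ hd) (c8_pos_small t d ht₀ ht hd₀ hd) hd₀ (by linarith))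

/-! ## The four conjuncts on SMALL -/

/-- ★ K1 BOUNDARY DOMINATION AT `R = 2` ON SMALL (rule `y0 = 1`, right-sided strict cone child with `0 < t ≤ 1/8`, `0 ≤ d < 1`, any top height `h`):
all four conjuncts of 110's `BdryDomForm`. -/
theorem bdryDomForm_two_K1_small (d t h : ℝ) (ht₀ : 0 < t) (ht : t ≤ ((1 : ℝ) / 8)) (hd₀ : (0 : ℝ) ≤ d) (hd1 : d < 1) (hcone : d * (2 - d) < t ^ 2) :
    BdryDomForm 2 d t h 1 (cornerSigmaForm 2 d t h 1) := by
  unfold BdryDomForm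
  rw [show ((2 : ℝ) / 2) = 1 by norm_num]
  refine ⟨fun b hb0 hb1 => ?_, fun b hb0 hb1 => ?_, fun ξ hξ => ?_, fun ξ hξ => ?_⟩
  · exact near_column_K1_small d t h b ht₀ ht hd₀ hd1 hcone hb0 hb1
  · exact far_column_K1_small d t h b ht₀ ht hd₀ hd1 hcone hb0 hb1
  · exact right_lid_K1_small d t h ξ ht₀ ht hd₀ hd1 hcone hξ
  · exact left_lid_K1_small d t h ξ ht₀ ht hd₀ hd1 hcone hξ

end RhW08.K1Small

end
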